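import Summits.BirchSwinnertonDyer.BirchSwinnertonDyer.Theorems.SignedLowerHalvesSmallImageLowerHalfBothSignsRttJunctionEulerId
import Literature.NumberTheory.EllipticCurves.CMNewformGamma0EulerFactorsPadicCharacter
import HarnessLib

/-!
# Route `SignedLowerHalves`, crux L `SmallImageLowerHalfBothSigns` (stmt-BirchSwinnertonDyer-23599), line `rtt_w3` **v25** — row **S1c** (`stub_junctionEulerId_ns`), part 3:
# THE ROW FROM THE NAMED PRINT FACT `Ribet1977_cmNewform_gamma0_eulerFactor_padicCharacter` — by-name closure recipe for the LEAD

INPUTS hand `bsd-inputs-honda-p1` g27 under LEAD `cruxlead-stmt-BirchSwinnertonDyer-23599` g13 (cell `bsd-ssimc`); helper `--supports stmt-BirchSwinnertonDyer-23599`.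
THEOREMS ONLY: no definition, no named fact, no instance, no `sorry`. Parts 1–2: `…RttJunctionEulerDict` (p811203), `…RttJunctionEulerId` (the row from the
hypothesis `hEul`). This file instantiates `hEul` from the Literature named fact `Literature.NumberTheory.EllipticCurves.ModularForms.Ribet1977_cmNewform_gamma0_eulerFactor_padicCharacter`
(Ribet 1977 §3 Thm. (3.4)/Cor. (3.5)/Remark (3.5) + Miyake Thm. 4.6.17/4.6.19/4.8.2 + Weil–Serre + Chebotarev: the Euler factors of the `Γ₀` CM newform through the `p`-adic character,
INCLUDING the primes `ℓ ∣ d_K·N𝔪`) at the data of the crux prefix: ★★★ `junctionEulerId_ns_of_print` — every binder is a binder of the registered stub (same names and types),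
plus the fact as hypothesis `hF`; the conclusion is the v25 conclusion with `JunctionDepletion`/`JunctionEuler` unfolded. CLOSING RECIPE (LEAD): add the fact to `stub_citedInputs_rtt`,
thread it as `hF`, and in `Lines/rtt_w3.lean` replace the `sorry` of `stub_junctionEulerId_ns` by `intro …` (the prefix) and
`exact SmallImageRttJunctionEuler.junctionEulerId_ns_of_print hF hp hκ hγ hcv σK 𝔪 ψ e hK2 htc h𝔪 hψ hψpow g ι hng hcoeffψ S θ hθ hγK S₀ hS₀p 𝔣 θ' hframe.2.2.1 hsupp.1 hsupp.2 T φ x d hT hφ hx`.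
HONEST FRAMING: S1c becomes a theorem MODULO the named print fact (a `conditional-result` until an INPUTS typer/prover discharges it); rows S3α/S3β/S4′, E2, crux L, crux M and
BSD remain OPEN; BSD is proved for NO curve.

References: [Ribet1977Nebentypus] §3; [Miyake2006] Thm. 4.6.17, 4.6.19, 4.8.2; [SerreAbelianLadic1968] Ch. I §2.3, Ch. II §2; [GreenbergVatsal2000] §1 p. 9, §2 Prop. (2.4).
-/

set_option autoImplicit false
set_option linter.dupNamespace false -- D-0017: single-problem summit, the namespace repeats the problem name by design
noncomputable section

open scoped Classical
open NumberField IsDedekindDomain Field PowerSeries Rat.HeightOneSpectrum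

namespace Summit.BirchSwinnertonDyer.BirchSwinnertonDyer.Theorems.SmallImageRttJunctionEuler

open Literature.NumberTheory.EllipticCurves Literature.NumberTheory.GaloisRepresentations Literature.NumberTheory.LFunctions
  Literature.NumberTheory.ComplexMultiplication.EllipticUnits Literature.NumberTheory.ComplexMultiplication.EllipticUnits.JohnsonLeungKings2011
  Literature.NumberTheory.EllipticCurves.ModularForms Literature.NumberTheory.Automorphic
  IsDedekindDomain.HeightOneSpectrum Literature.NumberTheory.EllipticCurves.GreenbergVatsal2000

section OfPrint

variable {p : ℕ} [Fact p.Prime]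

/-- ★★★ **ROW S1c OF LINE `rtt_w3` v25 FROM THE NAMED PRINT FACT.** Under the crux prefix data — `κ` cyclotomic with `κ γ = 1` on a cyclotomic variable `γ`; `K` totally
complex quadratic with `σK`, `𝔪 ≠ 0`, the Größencharakter values `ψ` of type `(1,0)` mod `𝔪` with trivial Nebentypus (`hψpow`); `e : ℚ̄_p ≃ ℂ`; the partner newform
`g ∈ S₂(Γ₀(M))` with `p`-adic embedding `ι` and `ι(a_ℓ(g)) = e⁻¹(Σ_{Nw=ℓ} ψ w)` off `d_K·N𝔪` (`hcoeffψ`); the pinned character `θ : Γ_K → GL₁(𝒪)` (`hθ`); `γK` a normalised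
generator of `κK`; `S₀ ∌ (p)`; the frame's `θ'` with `θ'·θ₀₀ = 1` and (R)/(U) for the level `𝔣` — and ASSUMING the print fact
`Ribet1977_cmNewform_gamma0_eulerFactor_padicCharacter`, S1's datum `(T, φ, x, d)` satisfies
**`∃ fv u c′, c′ ≠ 0 ∧ (∀ ℓ ∈ S₀, fv ℓ ≠ 0 ∧ v(fv ℓ) = v(f_ℓ)) ∧ ι(u · JunctionDepletion S θ' T φ x d) = C c′ · JunctionEuler p S₀ g ι fv`** (unfolded), with
`fv = −frobeniusExponent`, `u = 1`. [cite: Ribet1977Nebentypus, §3, Thm. (3.4), Cor. (3.5) and Remark (3.5)] [cite: Miyake2006, Thm. 4.6.19, Thm. 4.8.2]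
[cite: GreenbergVatsal2000, §1 p. 9, §2 Prop. (2.4)] [cite: Washington1997, §13.2] -/
theorem junctionEulerId_ns_of_print (hF : Ribet1977_cmNewform_gamma0_eulerFactor_padicCharacter)
    (hp : p ≠ 2) {κ : ZpExtension ℚ p} (hκ : κ.IsCyclotomic) {γ : absoluteGaloisGroup ℚ} (hγ : κ.IsTopGenerator γ) (hcv : IsCyclotomicVariable p γ)
    {K : Type} [Field K] [NumberField K] (σK : K →+* ℂ) (𝔪 : Ideal (𝓞 K)) (ψ : HeightOneSpectrum (𝓞 K) → ℂ) (e : PadicAlgCl p ≃+* ℂ)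
    (hK2 : Module.finrank ℚ K = 2) (htc : IsTotallyComplex K) (h𝔪 : 𝔪 ≠ ⊥)
    (hψ : IsGrossencharakter 𝔪 (embType σK) (embTypeConj σK) ψ)
    (hψpow : ∀ n : ℕ, Odd n → n.Coprime ((NumberField.discr K).natAbs * Ideal.absNorm 𝔪) →
      idealPow K ψ (Ideal.span {(n : 𝓞 K)}) = (jacobiSym (NumberField.discr K) n : ℂ) * (n : ℂ) ^ (2 - 1))
    {M : ℕ} [NeZero M] (g : CuspForm (CongruenceSubgroup.Gamma0 M) 2) (ι : ModularForms.coeffField g →+* PadicAlgCl p) (hng : IsNewform0 g)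
    (hcoeffψ : ∀ ℓ : ℕ, ℓ.Prime → ¬ ℓ ∣ (NumberField.discr K).natAbs * Ideal.absNorm 𝔪 →
      embCoeff g ι ℓ = e.symm (∑ᶠ (w : HeightOneSpectrum (𝓞 K)) (_ : Ideal.absNorm w.asIdeal = ℓ), ψ w))
    (S : Set (PadicAlgCl p)) (θ : FramedGaloisRep K (padicCoeffIntegers S) 1)
    (hθ : ∀ w : HeightOneSpectrum (𝓞 K), (p : 𝓞 K) ∉ w.asIdeal → ¬ 𝔪 ≤ w.asIdeal →
      θ.IsUnramifiedAt w ∧ ∃ P : Polynomial (padicCoeffIntegers S),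
        P.map (padicCoeffIntegers S).subtype = Polynomial.X - Polynomial.C (e.symm (ψ w)) ∧ θ.HasFrobCharpolyAt w P)
    {γK : absoluteGaloisGroup K} (hγK : (κ.restrictOfFinrankEqTwo hp K hK2).IsTopGenerator γK)
    (S₀ : Finset (HeightOneSpectrum (𝓞 ℚ))) (hS₀p : ∀ v ∈ S₀, ((p : ℕ) : 𝓞 ℚ) ∉ v.asIdeal) (𝔣 : Ideal (𝓞 K))
    (θ' : absoluteGaloisGroup K →ₜ* (padicCoeffIntegers S)ˣ)
    (hθ'θ : ∀ g : absoluteGaloisGroup K, ((θ' g : (padicCoeffIntegers S)ˣ) : padicCoeffIntegers S) *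
      ((θ g : GL (Fin 1) (padicCoeffIntegers S)) : Matrix (Fin 1) (Fin 1) (padicCoeffIntegers S)) 0 0 = 1)
    (hR : ∀ w ∈ suppPF p 𝔣, ((p : ℕ) : 𝓞 K) ∉ w.asIdeal → ∃ 𝔓 ∈ w.primesAbove, ∃ τ ∈ 𝔓.inertia (absoluteGaloisGroup K), θ' τ ≠ 1)
    (hU : ∀ w : HeightOneSpectrum (𝓞 K), w ∉ suppPF p 𝔣 → ∀ 𝔓 ∈ w.primesAbove, ∀ τ ∈ 𝔓.inertia (absoluteGaloisGroup K), θ' τ = 1)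
    (T : Finset (HeightOneSpectrum (𝓞 K))) (φ : HeightOneSpectrum (𝓞 K) → absoluteGaloisGroup K) (x : HeightOneSpectrum (𝓞 K) → ℤ_[p]) (d : ℕ)
    (hT : ∀ w, w ∈ T ↔ (w ∈ {w : HeightOneSpectrum (𝓞 K) | ∃ v ∈ S₀, ((natGenerator v : ℕ) : 𝓞 K) ∈ w.asIdeal} ∧ w ∉ suppPF p 𝔣))
    (hφ : ∀ w ∈ T, IsArithFrobAt (𝓞 K) (φ w) (adicCompletionPrime K w))
    (hx : ∀ w ∈ T, ∀ n : ℕ, γK⁻¹ ^ (PadicInt.toZModPow n (x w)).val * (φ w)⁻¹ ∈ (κ.restrictOfFinrankEqTwo hp K hK2).layerSubgroup n) :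
    ∃ (fv : HeightOneSpectrum (𝓞 ℚ) → ℤ_[p]) (u : (IwasawaAlgebraO S)ˣ) (c' : PadicAlgCl p), c' ≠ 0 ∧
      (∀ w ∈ S₀, fv w ≠ 0 ∧ (fv w).valuation = (frobeniusExponent p (natGenerator w : ℤ_[p])).valuation) ∧
      iwasawaOToPowerSeries S ((u : IwasawaAlgebraO S) * (PowerSeries.C ((p : padicCoeffIntegers S) ^ d) *
          ∏ w ∈ T, (iwasawaToIwasawaO S (PowerSeries.binomialSeries ℤ_[p] (x w)) -
            PowerSeries.C (((θ' (φ w) : (padicCoeffIntegers S)ˣ) : padicCoeffIntegers S) *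
              padicIntToCoeffIntegers S ((GaloisRep.cyclotomicCharacter K p (φ w) : ℤ_[p]ˣ) : ℤ_[p]))))) =
        PowerSeries.C c' * ∏ w ∈ S₀, Polynomial.aeval (PowerSeries.C ((natGenerator w : PadicAlgCl p)⁻¹) *
            (PowerSeries.binomialSeries ℤ_[p] (fv w)).map (algebraMap ℤ_[p] (PadicAlgCl p)))
          (1 - Polynomial.C (embCoeff g ι (natGenerator w)) * Polynomial.X +
            (if natGenerator w ∣ M then 0 else Polynomial.C (natGenerator w : PadicAlgCl p)) * (Polynomial.X : Polynomial (PadicAlgCl p)) ^ 2) :=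
  junctionEulerId_ns_of_eulerFactors hp hK2 hκ hγ hcv S θ θ' hθ'θ hγK S₀ hS₀p 𝔣 hR hU g ι
    (fun v hv Tv φ' dg hTv hφ' hdg ↦ hF K hK2 htc σK 𝔪 h𝔪 ψ hψ hψpow p e M g ι hng hcoeffψ S θ hθ (natGenerator v) (prime_natGenerator v)
      (Summit.BirchSwinnertonDyer.Rank1Residual.X2.EulerFactorInvariants.natGenerator_ne_of_natCast_not_mem v (hS₀p v hv)) Tv φ' dg hTv
      (fun w hw ↦ ⟨_, adicCompletionPrime_mem_primesAbove K w, hφ' w hw⟩) hdg)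
    T φ x d hT hφ hx

end OfPrint

end Summit.BirchSwinnertonDyer.BirchSwinnertonDyer.Theorems.SmallImageRttJunctionEuler

end
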